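import Summits.Ventures.PercRepro.SixFourResidueThreeGenericTable

/-!
# PercRepro — C-025 at `(6,4)`: Theorem G₃ at `g = 10` (the `U_{3,7}` remark of §21.16) (p2, gen 9)

At `g = 10` the per-pair inequality `PerPair3 10 p m` fails exactly once, at `(p, m) = (7, 2)`: a `7`-point plane all of
whose lines have `2` points (`U_{3,7}`) has slack `−7/5`.  §21.16's remark: for a generic `10`-point solid the three points
off such a plane are non-collinear, and the planes through two points of the `U_{3,7}` and one outside point are
`3`-point planes with slack `3·y₃_P/8 = 227/25`; at least `45` of the `63` candidates are genuinely `3`-point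
(a `4`-point plane `{a, b, x, w}` is a line of the `U_{3,7}` plus two outside points; each outside pair lies in planes
meeting the `U_{3,7}` in disjoint lines, at most `3`, each spoiling two candidates), so `J₃ ≥ −7/5 + 45·227/25 > 0`.
The accounting is per plane: `J₃ ≥ Σ_{P : r(P ∩ G) = 3} slack(P)` (`J_three_ge_sum_slack`), with
`slack(P) = Σ_λ L₃(m_λ) − base₃` (`slack_eq_sum_Lterm3`); at `(10, 7)` every line of `≥ 3` points contributes a gain
`L₃(m) − C(m,2)·L₃(2) ≥ 489/175 > 7/5` (`gain_ten_seven`), so every `7`-point plane that is not a `U_{3,7}` has slack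
`≥ 0`; planes with `p ≠ 7` have slack `≥ 0` by the per-pair inequality (`perPairCheckTen`), and `3`-point planes have
slack exactly `227/25`.
Main result: `J_three_nonneg_of_generic_ten : Generic M G → G.card = 10 → 0 ≤ J M G 3`.
-/

namespace PercRepro.SixFour

open Finset ThmH

variable {α : Type*} [DecidableEq α] {M : Matroid α} [M.Finite] {G : Finset α}

/-- The slack of a plane: `Σ_λ y₃_{m_λ}(p − m_λ) − cost₃ − lppCredit`. -/
noncomputable def slack3 (M : Matroid α) [M.Finite] (G P : Finset α) : ℚ :=
  certRHS3 M G P G.card - cost3 M G P - (lppCredit M G P : ℚ)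

/-- **`J₃ ≥ Σ_{P : r(P ∩ G) = 3} slack(P)`** for a generic solid (the accounting behind
`J_three_nonneg_of_generic_of_perPair`). -/
theorem J_three_ge_sum_slack (hs : Simple M) (hG : G ⊆ gr M) (hr : M.eRk (G : Set α) = 4) (hgen : Generic M G)
    (hg : 7 ≤ G.card) :
    ∑ P ∈ (planes M).filter (fun P : Finset α => M.eRk ((P ∩ G : Finset α) : Set α) = 3), slack3 M G P ≤ J M G 3 := by
  set S := (planes M).filter (fun P : Finset α => M.eRk ((P ∩ G : Finset α) : Set α) = 3) with hS
  have F1 := J_three_identity hs hG hr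
  have hX : X2cnt M G = 0 := X2cnt_eq_zero_of_generic hG hr hgen
  have F2 := sum_cost3_le_filter (M := M) G
  have F4 : ∑ P ∈ S, certRHS3 M G P G.card = ∑ P ∈ planes M, certRHS3 M G P G.card := by
    rw [hS]
    apply Finset.sum_subset (Finset.filter_subset _ _)
    intro P hP hPS
    rw [Finset.mem_filter, not_and] at hPS
    exact certRHS3_eq_zero_of_ne hs hG hP (hPS hP)
  have F56 : ∑ P ∈ planes M, certRHS3 M G P G.card =
      yP3 G.card * ∑ L ∈ lines M, ((L ∩ G).card.choose 2 : ℚ) + ∑ L ∈ lines M, bonus3 (L ∩ G).card +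
        ∑ L ∈ lines M, ((eps (L ∩ G).card : ℚ) * ((G.card - (L ∩ G).card).choose 2 : ℚ)) := by
    rw [sum_certRHS3_eq hs hG]
    rw [sum_lines_eq_sum_inc_rat G (fun m => (m.choose 2 : ℚ)), sum_lines_eq_sum_inc_rat G (fun m => bonus3 m),
      sum_lines_eq_sum_inc_rat G (fun m => (eps m : ℚ) * ((G.card - m).choose 2 : ℚ))]
    rw [Finset.mul_sum, ← Finset.sum_add_distrib, ← Finset.sum_add_distrib]
    refine Finset.sum_congr rfl (fun m hm => ?_)
    rw [Finset.mem_range] at hm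
    rcases Nat.lt_or_ge m G.card with hlt | hge
    · rw [price_identity3 hlt]
      unfold bLines
      ring
    · have hm' : m = G.card := by omega
      subst hm'
      rw [show bLines M G G.card = inc M G G.card from rfl, ← show bLines M G G.card = inc M G G.card from rfl,
        bLines_card_eq_zero hr]
      simp
  have F7 : ∑ L ∈ lines M, ((L ∩ G).card.choose 2 : ℚ) = (G.card.choose 2 : ℚ) := by
    exact_mod_cast sum_choose_two_trace hs hG
  have F9 : ∑ L ∈ lines M, ((eps (L ∩ G).card : ℚ) * ((crossPairs M G L).card : ℚ)) ≤ (lpp M G : ℚ) := by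
    have := lpp_ge hs hG
    have h' : ∑ L ∈ lines M, ((eps (L ∩ G).card : ℚ) * ((crossPairs M G L).card : ℚ)) =
        ((∑ L ∈ lines M, eps (L ∩ G).card * (crossPairs M G L).card : ℕ) : ℚ) := by push_cast; rfl
    rw [h']
    exact_mod_cast this
  have F10 : ∑ L ∈ lines M, ((eps (L ∩ G).card : ℚ) * ((G.card - (L ∩ G).card).choose 2 : ℚ)) ≤
      ∑ L ∈ lines M, ((eps (L ∩ G).card : ℚ) * ((crossPairs M G L).card : ℚ)) + ∑ P ∈ S, (lppCredit M G P : ℚ) := by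
    have := sum_eps_choose_le hs hG
    rw [← hS] at this
    have h1 : ∑ L ∈ lines M, ((eps (L ∩ G).card : ℚ) * ((G.card - (L ∩ G).card).choose 2 : ℚ)) =
        ((∑ L ∈ lines M, eps (L ∩ G).card * (G.card - (L ∩ G).card).choose 2 : ℕ) : ℚ) := by push_cast; rfl
    have h2 : ∑ L ∈ lines M, ((eps (L ∩ G).card : ℚ) * ((crossPairs M G L).card : ℚ)) =
        ((∑ L ∈ lines M, eps (L ∩ G).card * (crossPairs M G L).card : ℕ) : ℚ) := by push_cast; rfl
    have h3 : ∑ P ∈ S, (lppCredit M G P : ℚ) = ((∑ P ∈ S, lppCredit M G P : ℕ) : ℚ) := by push_cast; rfl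
    rw [h1, h2, h3, ← Nat.cast_add]
    exact_mod_cast this
  have F11 := F3_eq_yP3 (g := G.card) (by omega)
  have hslack : ∑ P ∈ S, slack3 M G P =
      ∑ P ∈ S, certRHS3 M G P G.card - ∑ P ∈ S, cost3 M G P - ∑ P ∈ S, (lppCredit M G P : ℚ) := by
    unfold slack3
    rw [Finset.sum_sub_distrib, Finset.sum_sub_distrib]
  rw [hslack, F1, hX]
  push_cast
  rw [F7] at F56
  linarith [F2, F4, F56, F9, F10, F11]

/-- **The slack in additive form**: `slack(P) = Σ_λ L₃(g, p, m_λ) − base₃(g, p)` on a rank-`3` trace. -/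
theorem slack_eq_sum_Lterm3 (hs : Simple M) (hG : G ⊆ gr M) {P : Finset α}
    (hr : M.eRk ((P ∩ G : Finset α) : Set α) = 3) :
    slack3 M G P = ∑ L ∈ lines M, Lterm3 G.card (P ∩ G).card (L ∩ (P ∩ G)).card - base3 G.card (P ∩ G).card := by
  set ρ := P ∩ G with hρdef
  have hρ : ρ ⊆ gr M := Finset.inter_subset_right.trans hG
  have hD : (D3 M G P : ℚ) = (delta ρ.card : ℚ) - ∑ L ∈ lines M, (delta (L ∩ ρ).card : ℚ) := by
    have h := D3_add_sum_delta hs hρ hr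
    have h' : (D3 M G P : ℚ) + ∑ L ∈ lines M, (delta (L ∩ ρ).card : ℚ) = (delta ρ.card : ℚ) := by
      unfold D3
      exact_mod_cast h
    linarith
  have hR : (r34 M G P : ℚ) = (ρ.card.choose 4 : ℚ) - ∑ L ∈ lines M, ((L ∩ ρ).card.choose 4 : ℚ) := by
    have h := r34_add_sum_choose_four hs hG hr
    have h' : (r34 M G P : ℚ) + ∑ L ∈ lines M, ((L ∩ ρ).card.choose 4 : ℚ) = (ρ.card.choose 4 : ℚ) := by
      exact_mod_cast h
    linarith
  have hL : (lppCredit M G P : ℚ) = ∑ L ∈ lines M, ((eps (L ∩ ρ).card : ℚ) * ((ρ.card - (L ∩ ρ).card).choose 2 : ℚ)) := by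
    unfold lppCredit
    push_cast
    rfl
  have hsplit : ∑ L ∈ lines M, Lterm3 G.card ρ.card (L ∩ ρ).card =
      ∑ L ∈ lines M, yPrice3 G.card (L ∩ ρ).card * ((ρ.card - (L ∩ ρ).card : ℕ) : ℚ) +
        (9 / 5 + 3 / 2 * ((G.card : ℚ) - ρ.card)) * ∑ L ∈ lines M, (delta (L ∩ ρ).card : ℚ) -
        12 / 5 * ∑ L ∈ lines M, ((L ∩ ρ).card.choose 4 : ℚ) -
        ∑ L ∈ lines M, ((eps (L ∩ ρ).card : ℚ) * ((ρ.card - (L ∩ ρ).card).choose 2 : ℚ)) := by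
    simp only [Lterm3, Finset.sum_add_distrib, Finset.sum_sub_distrib, Finset.mul_sum]
  unfold slack3 certRHS3 cost3 base3
  rw [← hρdef, hsplit, hD, hR, hL]
  ring

/-- The per-pair inequality at `g = 10` for `p ≠ 7` (`3 ≤ p ≤ 6`). -/
theorem perPairCheckTen : ∀ p < 7, ∀ m < p, (!decide (3 ≤ p ∧ 2 ≤ m) || decide (PerPairN 10 p m)) = true := by
  decide

/-- `PerPair3 10 p m` for `3 ≤ p ≤ 6`, `2 ≤ m < p`. -/
theorem perPair3_ten {p m : ℕ} (hp : 3 ≤ p) (hp7 : p ≤ 6) (hm : 2 ≤ m) (hmp : m < p) : PerPair3 10 p m := by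
  have hc := perPairCheckTen p (by omega) m hmp
  rw [Bool.or_eq_true, Bool.not_eq_true', decide_eq_false_iff_not, decide_eq_true_eq] at hc
  exact perPair3_of_perPairN (by omega) (by norm_num) (hc.resolve_left (not_not.2 ⟨hp, hm⟩))

/-- `21·L₃(10, 7, 2) − base₃(10, 7) = −7/5`: the slack of a `U_{3,7}` plane in a `10`-point solid. -/
theorem u37_slack : 21 * Lterm3 10 7 2 - base3 10 7 = -7 / 5 := by
  unfold Lterm3 base3 yPrice3 yP3 F3 bonus3
  simp only [S3, S2, delta, eps]
  norm_num [Nat.choose]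

/-- **The gain of a long line at `(10, 7)`**: `L₃(10, 7, m) − C(m,2)·L₃(10, 7, 2) ≥ 7/5` for `3 ≤ m ≤ 6`. -/
theorem gain_ten_seven {m : ℕ} (hm : 3 ≤ m) (hm' : m ≤ 6) :
    7 / 5 ≤ Lterm3 10 7 m - (m.choose 2 : ℚ) * Lterm3 10 7 2 := by
  interval_cases m <;> (unfold Lterm3 yPrice3 yP3 F3 bonus3; simp only [S3, S2, delta, eps]; norm_num [Nat.choose])

/-- `L₃(10, 7, m) − C(m,2)·L₃(10, 7, 2) = 0` for `m ≤ 2`. -/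
theorem gain_ten_seven_small {m : ℕ} (hm : m ≤ 2) : Lterm3 10 7 m - (m.choose 2 : ℚ) * Lterm3 10 7 2 = 0 := by
  interval_cases m
  · rw [Lterm3_eq_zero_of_le_one 10 7 (by norm_num)]; simp
  · rw [Lterm3_eq_zero_of_le_one 10 7 (by norm_num)]; simp
  · simp

/-- The slack of a `3`-point plane at `g = 10` is `227/25`. -/
theorem slack_three_point : 3 * Lterm3 10 3 2 - base3 10 3 = 227 / 25 := by
  unfold Lterm3 base3 yPrice3 yP3 F3 bonus3
  simp only [S3, S2, delta, eps]
  norm_num [Nat.choose]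

/-- The line sizes of a rank-`3` trace are `< p`. -/
theorem line_lt_trace {P : Finset α} (hr3 : M.eRk ((P ∩ G : Finset α) : Set α) = 3) {L : Finset α}
    (hL : L ∈ lines M) : (L ∩ (P ∩ G)).card < (P ∩ G).card := by
  have hle : (L ∩ (P ∩ G)).card ≤ (P ∩ G).card := Finset.card_le_card Finset.inter_subset_right
  rcases Nat.lt_or_ge (L ∩ (P ∩ G)).card (P ∩ G).card with h | h
  · exact h
  · exfalso
    have heq : L ∩ (P ∩ G) = P ∩ G := Finset.eq_of_subset_of_card_le Finset.inter_subset_right h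
    have hsub : P ∩ G ⊆ L := by rw [← heq]; exact Finset.inter_subset_left
    have h2 := M.eRk_mono (Finset.coe_subset.2 hsub)
    rw [hr3, (mem_lines.1 hL).2.2] at h2
    have h32 : (3 : ℕ) ≤ 2 := by exact_mod_cast h2
    omega

/-! ## The slacks of the planes of a generic `10`-point solid -/

section Ten

variable (hs : Simple M) (hG : G ⊆ gr M) (hr : M.eRk (G : Set α) = 4) (hgen : Generic M G) (hg : G.card = 10)
include hs hG hr hgen hg

omit hr in
/-- A rank-`3` plane trace with `p ≠ 7` points has slack `≥ 0` (`p ≤ 7` in a generic `10`-point solid). -/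
theorem slack_nonneg_of_ne_seven {P : Finset α} (hP : P ∈ planes M) (hr3 : M.eRk ((P ∩ G : Finset α) : Set α) = 3)
    (hne : (P ∩ G).card ≠ 7) : 0 ≤ slack3 M G P := by
  have h7 := card_trace_add_three_le_of_generic hgen hP
  have hp3 := three_le_card_of_eRk_eq_three hr3
  have hc := cert_plane_of_perPair hs hG hr3 (fun m hm2 hmp => by
    rw [hg]
    exact perPair3_ten hp3 (by omega) hm2 hmp)
  unfold slack3
  linarith

omit hr hgen in
/-- A `7`-point rank-`3` trace with a line of `≥ 3` points has slack `≥ 0`. -/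
theorem slack_nonneg_of_seven_of_line {P : Finset α} (hr3 : M.eRk ((P ∩ G : Finset α) : Set α) = 3)
    (h7 : (P ∩ G).card = 7) {L₀ : Finset α} (hL₀ : L₀ ∈ lines M) (h3 : 3 ≤ (L₀ ∩ (P ∩ G)).card) : 0 ≤ slack3 M G P := by
  rw [slack_eq_sum_Lterm3 hs hG hr3, hg, h7]
  have hpairs : ∑ L ∈ lines M, ((L ∩ (P ∩ G)).card.choose 2 : ℚ) = 21 := by
    have := sum_choose_two_trace hs (Finset.inter_subset_right.trans hG : P ∩ G ⊆ gr M)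
    rw [h7] at this
    exact_mod_cast this
  -- write each term as `gain + C(m,2)·L₃(2)`
  have hdecomp : ∑ L ∈ lines M, Lterm3 10 7 (L ∩ (P ∩ G)).card =
      ∑ L ∈ lines M, (Lterm3 10 7 (L ∩ (P ∩ G)).card - ((L ∩ (P ∩ G)).card.choose 2 : ℚ) * Lterm3 10 7 2) +
        21 * Lterm3 10 7 2 := by
    rw [Finset.sum_sub_distrib, ← Finset.sum_mul, hpairs]
    ring
  have hgain : ∀ L ∈ lines M, 0 ≤ Lterm3 10 7 (L ∩ (P ∩ G)).card - ((L ∩ (P ∩ G)).card.choose 2 : ℚ) * Lterm3 10 7 2 := by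
    intro L hL
    have hlt := line_lt_trace hr3 hL
    rcases Nat.lt_or_ge (L ∩ (P ∩ G)).card 3 with h | h
    · rw [gain_ten_seven_small (by omega)]
    · linarith [gain_ten_seven h (by omega)]
  have hL₀lt := line_lt_trace hr3 hL₀
  have hbig : 7 / 5 ≤ ∑ L ∈ lines M, (Lterm3 10 7 (L ∩ (P ∩ G)).card - ((L ∩ (P ∩ G)).card.choose 2 : ℚ) * Lterm3 10 7 2) := by
    calc (7 / 5 : ℚ) ≤ Lterm3 10 7 (L₀ ∩ (P ∩ G)).card - ((L₀ ∩ (P ∩ G)).card.choose 2 : ℚ) * Lterm3 10 7 2 :=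
          gain_ten_seven h3 (by omega)
      _ ≤ _ := Finset.single_le_sum hgain hL₀
  rw [hdecomp]
  linarith [u37_slack]

omit hr hgen in
/-- A `7`-point rank-`3` trace all of whose lines have `≤ 2` points (a `U_{3,7}`) has slack `−7/5`. -/
theorem slack_eq_of_seven_u37 {P : Finset α} (hr3 : M.eRk ((P ∩ G : Finset α) : Set α) = 3)
    (h7 : (P ∩ G).card = 7) (hall : ∀ L ∈ lines M, (L ∩ (P ∩ G)).card ≤ 2) : slack3 M G P = -7 / 5 := by
  rw [slack_eq_sum_Lterm3 hs hG hr3, hg, h7]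
  have hpairs : ∑ L ∈ lines M, ((L ∩ (P ∩ G)).card.choose 2 : ℚ) = 21 := by
    have := sum_choose_two_trace hs (Finset.inter_subset_right.trans hG : P ∩ G ⊆ gr M)
    rw [h7] at this
    exact_mod_cast this
  have hdecomp : ∑ L ∈ lines M, Lterm3 10 7 (L ∩ (P ∩ G)).card =
      ∑ L ∈ lines M, (Lterm3 10 7 (L ∩ (P ∩ G)).card - ((L ∩ (P ∩ G)).card.choose 2 : ℚ) * Lterm3 10 7 2) +
        21 * Lterm3 10 7 2 := by
    rw [Finset.sum_sub_distrib, ← Finset.sum_mul, hpairs]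
    ring
  have hzero : ∑ L ∈ lines M, (Lterm3 10 7 (L ∩ (P ∩ G)).card - ((L ∩ (P ∩ G)).card.choose 2 : ℚ) * Lterm3 10 7 2) = 0 :=
    Finset.sum_eq_zero (fun L hL => gain_ten_seven_small (hall L hL))
  rw [hdecomp, hzero]
  linarith [u37_slack]

omit hr hgen in
/-- A `3`-point rank-`3` trace has slack `227/25`. -/
theorem slack_eq_of_three {P : Finset α} (hr3 : M.eRk ((P ∩ G : Finset α) : Set α) = 3) (h3 : (P ∩ G).card = 3) :
    slack3 M G P = 227 / 25 := by
  rw [slack_eq_sum_Lterm3 hs hG hr3, hg, h3]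
  have hpairs : ∑ L ∈ lines M, ((L ∩ (P ∩ G)).card.choose 2 : ℚ) = 3 := by
    have := sum_choose_two_trace hs (Finset.inter_subset_right.trans hG : P ∩ G ⊆ gr M)
    rw [h3] at this
    exact_mod_cast this
  have hterm : ∀ L ∈ lines M, Lterm3 10 3 (L ∩ (P ∩ G)).card = ((L ∩ (P ∩ G)).card.choose 2 : ℚ) * Lterm3 10 3 2 := by
    intro L hL
    have hlt := line_lt_trace hr3 hL
    rw [h3] at hlt
    interval_cases hm : (L ∩ (P ∩ G)).card
    · rw [Lterm3_eq_zero_of_le_one 10 3 (by norm_num)]; simp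
    · rw [Lterm3_eq_zero_of_le_one 10 3 (by norm_num)]; simp
    · simp
  rw [Finset.sum_congr rfl hterm, ← Finset.sum_mul, hpairs]
  linarith [slack_three_point]

end Ten

end PercRepro.SixFour
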